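import Summits.ResolutionOfSingularities.ResolutionOfSingularities.Theorems.FrobeniusLadderFInjectiveMacaulayficationPencilPairPrimality
import Summits.ResolutionOfSingularities.ResolutionOfSingularities.Theorems.FrobeniusLadderFInjectiveMacaulayficationPencilQuotFinSucc
import Summits.ResolutionOfSingularities.ResolutionOfSingularities.Theorems.FrobeniusLadderFInjectiveMacaulayficationOmegaQstarPencilInput
import HarnessLib

/-!
# BED Ω, GLOBAL PATCH (g-b), F4 (c) ON B9 — THE PRIMES OF THE TWELVE PENCIL CHARTS: the three strict transforms `θ_T1 = 1 + y₃(1 + y₀⁹ + y₁⁹ + y₂⁹)` (charts 0/6/12/18),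
# `θ_T2 = y₃ + 1 + y₀⁹ + y₁⁹ + y₂⁹` (charts 4/10/16/22), `θ_T3 = y₀²y₄ + 1 + y₁⁹ + y₂⁹ + y₃⁹` (charts 5/11/17/23) are prime, and the twelve pair ideals `(θ_c, χ_c)` (`χ_c` = the strict
# transform of `g = x u² − y³`) are PRIME in `k[y₀..y₄]` — the regular-pair input of the 0BIQ identification of `S′_{Ω₁}` over the charts of `X̃_{B9}` meeting `E₉ ∪ E₁₀`
# (crux `FInjectiveMacaulayfication` stmt-ResolutionOfSingularities-15315, chain w45a; res-L1-w45a-plan-1 BOOKED 2026-08-29T08:08:13Z «F4(c) GLUE»; seat res-L1-w45a-stub-3 g14)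

[OURS · L1 W4.5a] Support file (`--supports stmt-ResolutionOfSingularities-15315 --as helper`); theorems only; any field `k`; no named fact; NOT a statement of any manuscript; nothing of the crux
is proved. AI-written (AI review is weaker than expert review). Chart coordinates `y₀..y₄ = X 0..X 4` are the rows of `B9NewtonKFan.Vq c` (the cone's rays in table order).
* §0 `prime_sq_sub_cube` (`y₀² − y₁³` prime in any `k[y₀, …, y_{m+1}]`); §1 the `χ`-shapes in four letters `G0, G6, G12, G18 ∈ k[z₀..z₃]` and in three letters `H5, H11, H17, H23 ∈ k[w₀..w₂]`
  are prime (✓ `prime_pencilPhiAffine`, ✓ `OmegaQstarPencilInput.prime_B`, variable swaps); §2 `prime_thetaT1/T2/T3`; §3 ★ the twelve `isPrime_pair_c` via ✓ `pencilChart_isPrime(_last)`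
  transported along `Equiv.swap 0 3` (pencil variable `y₃`) resp. directly (pencil variable `y₄`, `hreg` by ✓ `PencilPairPrimality.reg_of_free`).
[folklore; cite: Matsumura1987, Thm. 17.4]
-/

set_option linter.dupNamespace false

noncomputable section

open MvPolynomial

namespace Summit.ResolutionOfSingularities.ResolutionOfSingularities.Theorems.FInjectiveMacaulayfication.B9OmegaChartPrimes

open Summit.ResolutionOfSingularities.ResolutionOfSingularities.Theorems.FInjectiveMacaulayfication
open PencilPairPrimality

variable (k : Type) [Field k]

/-! ## §0 The cusp `y₀² − y₁³` is prime in any number of variables -/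

/-- `q² ≠ y₀³` in `k[y₀, …, y_m]` (total degree). [elementary] -/
theorem sq_ne_X_pow_three {m : ℕ} (q : MvPolynomial (Fin (m + 1)) k) : q ^ 2 ≠ (X 0) ^ 3 := by
  intro h
  have hq : q ≠ 0 := by
    intro hq
    rw [hq, zero_pow two_ne_zero] at h
    exact (pow_ne_zero 3 (X_ne_zero (0 : Fin (m + 1)))) h.symm
  have hdeg := congrArg totalDegree h
  rw [pow_two, totalDegree_mul_of_isDomain hq hq, totalDegree_X_pow] at hdeg
  omega

/-- **The cusp `y₀² − y₁³` is prime in `k[y₀, …, y_{m+1}]`** (monic quadratic in `y₀` over `k[y₁, …]` without a root). [folklore] -/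
-- adapted from `OmegaOneFloorInput.prime_B` (the case `m = 2`)
theorem prime_sq_sub_cube {m : ℕ} : Prime (X 0 ^ 2 - X 1 ^ 3 : MvPolynomial (Fin (m + 2)) k) := by
  have hmonic : (Polynomial.X ^ 2 - Polynomial.C ((X 0 : MvPolynomial (Fin (m + 1)) k) ^ 3)).Monic := Polynomial.monic_X_pow_sub_C _ two_ne_zero
  have hirr : Irreducible (Polynomial.X ^ 2 - Polynomial.C ((X 0 : MvPolynomial (Fin (m + 1)) k) ^ 3)) := by
    rw [hmonic.irreducible_iff_roots_eq_zero_of_degree_le_three (by rw [Polynomial.natDegree_X_pow_sub_C]) (by rw [Polynomial.natDegree_X_pow_sub_C]; omega),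
      Multiset.eq_zero_iff_forall_notMem]
    intro a ha
    rw [Polynomial.mem_roots hmonic.ne_zero, Polynomial.IsRoot, Polynomial.eval_sub, Polynomial.eval_pow, Polynomial.eval_X, Polynomial.eval_C, sub_eq_zero] at ha
    exact sq_ne_X_pow_three k a ha
  have he : finSuccEquiv k (m + 1) (X 0 ^ 2 - X 1 ^ 3 : MvPolynomial (Fin (m + 2)) k) = Polynomial.X ^ 2 - Polynomial.C ((X 0 : MvPolynomial (Fin (m + 1)) k) ^ 3) := by
    rw [map_sub, map_pow, map_pow, finSuccEquiv_X_zero, ← Fin.succ_zero_eq_one, finSuccEquiv_X_succ, ← map_pow]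
  rw [← he] at hirr
  exact ((MulEquiv.irreducible_iff (finSuccEquiv k (m + 1)).toMulEquiv).mp hirr).prime

/-! ## §1 The `χ`-shapes are prime -/

/-- Regularity of `B` modulo a monomial `y^M` from «no variable of `y^M` divides `B`» in the `Ideal.span` currency of ✓ `prime_pencilPhiAffine`. [bookkeeping] -/
theorem hreg_monomial {n : ℕ} (B : MvPolynomial (Fin n) k) (M : Fin n →₀ ℕ) (h : ∀ i, M i ≠ 0 → ¬ (X i : MvPolynomial (Fin n) k) ∣ B) :
    ∀ t : MvPolynomial (Fin n) k, B * t ∈ Ideal.span {monomial M (1 : k)} → t ∈ Ideal.span {monomial M (1 : k)} := by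
  intro t ht
  rw [Ideal.mem_span_singleton] at ht ⊢
  exact PencilPhiPrime.monomial_dvd_of_dvd_mul k B M h t ht

/-- `G6 = z₀²z₁ − 1` is prime in `k[z₀..z₃]`. [folklore] -/
theorem prime_G6 : Prime (X 0 ^ 2 * X 1 - 1 : MvPolynomial (Fin 4) k) := by
  have h := PencilPhiPrime.prime_pencilPhiAffine k (X 0 ^ 2 : MvPolynomial (Fin 3) k) 1 (pow_ne_zero _ (X_ne_zero _)) (fun t ht => by simpa using ht)
  have h' := prime_rename_equiv k (Equiv.swap (0 : Fin 4) 1) h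
  have e : rename (Equiv.swap (0 : Fin 4) 1) (rename Fin.succ (X 0 ^ 2 : MvPolynomial (Fin 3) k) * X 0 - rename Fin.succ 1) = X 0 ^ 2 * X 1 - 1 := by
    simp [rename_X]
  rwa [e] at h'

/-- `G12 = z₁ − z₀³` is prime in `k[z₀..z₃]`. [folklore] -/
theorem prime_G12 : Prime (X 1 - X 0 ^ 3 : MvPolynomial (Fin 4) k) := by
  have h := PencilPhiPrime.prime_pencilPhiAffine k (1 : MvPolynomial (Fin 3) k) (X 0 ^ 3) one_ne_zero (fun t _ => by simp [Ideal.span_singleton_one])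
  have h' := prime_rename_equiv k (Equiv.swap (0 : Fin 4) 1) h
  have e : rename (Equiv.swap (0 : Fin 4) 1) (rename Fin.succ (1 : MvPolynomial (Fin 3) k) * X 0 - rename Fin.succ (X 0 ^ 3)) = X 1 - X 0 ^ 3 := by
    simp [rename_X]
  rwa [e] at h'

/-- `G18 = z₂²z₁ − z₀³` is prime in `k[z₀..z₃]` (✓ `OmegaQstarPencilInput.prime_B`, negated). [folklore] -/
theorem prime_G18 : Prime (X 2 ^ 2 * X 1 - X 0 ^ 3 : MvPolynomial (Fin 4) k) := by
  have h := (OmegaQstarPencilInput.prime_B k).neg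
  have e : -(X 0 ^ 3 - X 1 * X 2 ^ 2 : MvPolynomial (Fin 4) k) = X 2 ^ 2 * X 1 - X 0 ^ 3 := by ring
  rwa [e] at h

/-- `H5 = w₁² − w₂³` is prime in `k[w₀, w₁, w₂]`. [folklore] -/
theorem prime_H5 : Prime (X 1 ^ 2 - X 2 ^ 3 : MvPolynomial (Fin 3) k) := by
  have h' := prime_rename_equiv k (finRotate 3) (prime_sq_sub_cube k (m := 1))
  have e : rename (finRotate 3) (X 0 ^ 2 - X 1 ^ 3 : MvPolynomial (Fin 3) k) = X 1 ^ 2 - X 2 ^ 3 := by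
    have h0 : (finRotate 3) 0 = 1 := by decide
    have h1 : (finRotate 3) 1 = 2 := by decide
    simp [rename_X, h0, h1]
  rwa [e] at h'

/-- `H11 = w₁²w₂ − 1` is prime in `k[w₀, w₁, w₂]`. [folklore] -/
theorem prime_H11 : Prime (X 1 ^ 2 * X 2 - 1 : MvPolynomial (Fin 3) k) := by
  have h := PencilPhiPrime.prime_pencilPhiAffine k (X 0 ^ 2 : MvPolynomial (Fin 2) k) 1 (pow_ne_zero _ (X_ne_zero _)) (fun t ht => by simpa using ht)
  have h' := prime_rename_equiv k (Equiv.swap (0 : Fin 3) 2) h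
  have e : rename (Equiv.swap (0 : Fin 3) 2) (rename Fin.succ (X 0 ^ 2 : MvPolynomial (Fin 2) k) * X 0 - rename Fin.succ 1) = X 1 ^ 2 * X 2 - 1 := by
    simp [rename_X, Equiv.swap_apply_of_ne_of_ne]
  rwa [e] at h'

/-- `H17 = w₂ − w₁³` is prime in `k[w₀, w₁, w₂]`. [folklore] -/
theorem prime_H17 : Prime (X 2 - X 1 ^ 3 : MvPolynomial (Fin 3) k) := by
  have h := PencilPhiPrime.prime_pencilPhiAffine k (1 : MvPolynomial (Fin 2) k) (X 0 ^ 3) one_ne_zero (fun t _ => by simp [Ideal.span_singleton_one])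
  have h' := prime_rename_equiv k (Equiv.swap (0 : Fin 3) 2) h
  have e : rename (Equiv.swap (0 : Fin 3) 2) (rename Fin.succ (1 : MvPolynomial (Fin 2) k) * X 0 - rename Fin.succ (X 0 ^ 3)) = X 2 - X 1 ^ 3 := by
    simp [rename_X, Equiv.swap_apply_of_ne_of_ne]
  rwa [e] at h'

/-- `H23 = w₀²w₂ − w₁³` is prime in `k[w₀, w₁, w₂]`. [folklore] -/
theorem prime_H23 : Prime (X 0 ^ 2 * X 2 - X 1 ^ 3 : MvPolynomial (Fin 3) k) := by
  have hreg := hreg_monomial k (X 0 ^ 3 : MvPolynomial (Fin 2) k) (Finsupp.single 1 2)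
    (fun i hi => by
      have : i = 1 := by
        by_contra hne; exact hi (Finsupp.single_eq_of_ne hne)
      subst this
      exact not_dvd_of_eval k (![1, 0] : Fin 2 → k) (by simp) (by simp))
  have h := PencilPhiPrime.prime_pencilPhiAffine k (monomial (Finsupp.single 1 2) (1 : k) : MvPolynomial (Fin 2) k) (X 0 ^ 3)
    (monomial_eq_zero.not.mpr one_ne_zero) hreg
  have h' := prime_rename_equiv k (Equiv.swap (0 : Fin 3) 2) h
  have e : rename (Equiv.swap (0 : Fin 3) 2) (rename Fin.succ (monomial (Finsupp.single 1 2) (1 : k) : MvPolynomial (Fin 2) k) * X 0 - rename Fin.succ (X 0 ^ 3)) =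
      X 0 ^ 2 * X 2 - X 1 ^ 3 := by
    rw [← X_pow_eq_monomial]
    simp [rename_X, Equiv.swap_apply_of_ne_of_ne]
  rwa [e] at h'

/-! ## §2 The three strict transforms of `f_B9` on the pencil charts are prime -/

/-- **`θ_T2 = y₃ + (1 + y₀⁹ + y₁⁹ + y₂⁹)` is prime** (charts 4/10/16/22; linear in `y₃`). [elementary] -/
theorem prime_thetaT2 : Prime (X 3 + (1 + X 0 ^ 9 + X 1 ^ 9 + X 2 ^ 9) : MvPolynomial (Fin 5) k) := by
  have h := PencilPhiPrime.prime_pencilPhiAffine k (1 : MvPolynomial (Fin 4) k) (-(1 + X 0 ^ 9 + X 1 ^ 9 + X 2 ^ 9)) one_ne_zero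
    (fun t _ => by simp [Ideal.span_singleton_one])
  have h' := prime_rename_equiv k (Equiv.swap (0 : Fin 5) 3) h
  have e : rename (Equiv.swap (0 : Fin 5) 3) (rename Fin.succ (1 : MvPolynomial (Fin 4) k) * X 0 - rename Fin.succ (-(1 + X 0 ^ 9 + X 1 ^ 9 + X 2 ^ 9))) =
      X 3 + (1 + X 0 ^ 9 + X 1 ^ 9 + X 2 ^ 9) := by
    simp [rename_X, Equiv.swap_apply_of_ne_of_ne]; ring
  rwa [e] at h'

/-- **`θ_T1 = 1 + y₃·(1 + y₀⁹ + y₁⁹ + y₂⁹)` is prime** (charts 0/6/12/18; primitive linear in `y₃`). [elementary] -/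
theorem prime_thetaT1 : Prime (1 + X 3 * (1 + X 0 ^ 9 + X 1 ^ 9 + X 2 ^ 9) : MvPolynomial (Fin 5) k) := by
  have hM : (1 + X 0 ^ 9 + X 1 ^ 9 + X 2 ^ 9 : MvPolynomial (Fin 4) k) ≠ 0 := fun h => by
    have := congrArg constantCoeff h
    simp at this
  have h := PencilPhiPrime.prime_pencilPhiAffine k (1 + X 0 ^ 9 + X 1 ^ 9 + X 2 ^ 9 : MvPolynomial (Fin 4) k) (-1) hM
    (fun t ht => by rwa [neg_one_mul, Ideal.neg_mem_iff] at ht)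
  have h' := prime_rename_equiv k (Equiv.swap (0 : Fin 5) 3) h
  have e : rename (Equiv.swap (0 : Fin 5) 3) (rename Fin.succ (1 + X 0 ^ 9 + X 1 ^ 9 + X 2 ^ 9 : MvPolynomial (Fin 4) k) * X 0 - rename Fin.succ (-1)) =
      1 + X 3 * (1 + X 0 ^ 9 + X 1 ^ 9 + X 2 ^ 9) := by
    simp [rename_X, Equiv.swap_apply_of_ne_of_ne]; ring
  rwa [e] at h'

/-- **`θ_T3 = y₀²y₄ + (1 + y₁⁹ + y₂⁹ + y₃⁹)` is prime** (charts 5/11/17/23; linear in `y₄` with coefficient `y₀²` prime to the constant term). [elementary] -/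
theorem prime_thetaT3 : Prime (X 0 ^ 2 * X 4 + (1 + X 1 ^ 9 + X 2 ^ 9 + X 3 ^ 9) : MvPolynomial (Fin 5) k) := by
  have hreg := hreg_monomial k (-(1 + X 0 ^ 9 + X 1 ^ 9 + X 2 ^ 9) : MvPolynomial (Fin 4) k) (Finsupp.single 3 2)
    (fun i hi => by
      have : i = 3 := by
        by_contra hne; exact hi (Finsupp.single_eq_of_ne hne)
      subst this
      exact not_dvd_of_eval k (![0, 0, 0, 0] : Fin 4 → k) (by simp) (by simp))
  have h := PencilPhiPrime.prime_pencilPhiAffine k (monomial (Finsupp.single 3 2) (1 : k) : MvPolynomial (Fin 4) k) (-(1 + X 0 ^ 9 + X 1 ^ 9 + X 2 ^ 9))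
    (monomial_eq_zero.not.mpr one_ne_zero) hreg
  have h' := prime_rename_equiv k (Equiv.swap (0 : Fin 5) 4) h
  have e : rename (Equiv.swap (0 : Fin 5) 4) (rename Fin.succ (monomial (Finsupp.single 3 2) (1 : k) : MvPolynomial (Fin 4) k) * X 0 -
      rename Fin.succ (-(1 + X 0 ^ 9 + X 1 ^ 9 + X 2 ^ 9))) = X 0 ^ 2 * X 4 + (1 + X 1 ^ 9 + X 2 ^ 9 + X 3 ^ 9) := by
    rw [← X_pow_eq_monomial]
    simp [rename_X, Equiv.swap_apply_of_ne_of_ne]; ring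
  rwa [e] at h'

/-! ## §3 The pair ideals `(θ_c, χ_c)` are prime -/

/-- **Pencil variable `y₃` (charts of types T1/T2)**: transport of ✓ `pencilChart_isPrime` (pencil variable `Y₀`) along `Equiv.swap 0 3`. [folklore] -/
theorem isPrime_pair_of_swap03 (G M B : MvPolynomial (Fin 4) k) (hG : Prime G) (hGM : ¬ G ∣ M)
    (hreg : ∀ t : MvPolynomial (Fin 4) k, B * t ∈ Ideal.span {G, M} → t ∈ Ideal.span {G, M}) (θ χ : MvPolynomial (Fin 5) k)
    (eθ : rename (Equiv.swap (0 : Fin 5) 3) (rename Fin.succ M * X 0 - rename Fin.succ B) = θ) (eχ : rename (Equiv.swap (0 : Fin 5) 3) (rename Fin.succ G) = χ) :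
    (Ideal.span {θ, χ} : Ideal (MvPolynomial (Fin 5) k)).IsPrime := by
  have h := isPrime_span_pair_rename_equiv k (Equiv.swap (0 : Fin 5) 3) (PencilIntegral.pencilChart_isPrime k G M B hG hGM hreg)
  rw [eθ, eχ, Set.pair_comm] at h
  exact h

/-- **Pencil variable `y₄` (charts of type T3)**: ✓ `pencilChart_isPrime_last` with `G = χ₃⁺`, `M = y₀²`, `B = −T₃⁺` (`χ₃, T₃ ∈ k[w₀, w₁, w₂]` free of `y₀`; `hreg` by ✓ `reg_of_free`). [folklore] -/
theorem isPrime_pair_T3 (χ₃ T₃ : MvPolynomial (Fin 3) k) (hχ : Prime χ₃) (hT : ¬ χ₃ ∣ T₃) (hGM : ¬ (rename Fin.succ χ₃ : MvPolynomial (Fin 4) k) ∣ X 0 ^ 2)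
    (θ χ : MvPolynomial (Fin 5) k)
    (eθ : rename Fin.castSucc (X 0 ^ 2 : MvPolynomial (Fin 4) k) * X (Fin.last 4) - rename Fin.castSucc (-(rename Fin.succ T₃ : MvPolynomial (Fin 4) k)) = θ)
    (eχ : rename Fin.castSucc (rename Fin.succ χ₃ : MvPolynomial (Fin 4) k) = χ) :
    (Ideal.span {θ, χ} : Ideal (MvPolynomial (Fin 5) k)).IsPrime := by
  have hreg : ∀ t : MvPolynomial (Fin 4) k, -(rename Fin.succ T₃ : MvPolynomial (Fin 4) k) * t ∈ Ideal.span {rename Fin.succ χ₃, (X 0 : MvPolynomial (Fin 4) k) ^ 2} →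
      t ∈ Ideal.span {rename Fin.succ χ₃, (X 0 : MvPolynomial (Fin 4) k) ^ 2} :=
    fun t ht => reg_of_free k χ₃ T₃ hχ hT 2 t (by rwa [neg_mul, Ideal.neg_mem_iff] at ht)
  have h := PencilIntegral.pencilChart_isPrime_last k (rename Fin.succ χ₃) (X 0 ^ 2) (-(rename Fin.succ T₃)) (PencilQuotFinSucc.prime_rename_succ k hχ) hGM hreg
  rw [eθ, eχ, Set.pair_comm] at h
  exact h


/-- ★ Chart 0 (type T1): `(θ_T1, X 1 ^ 2 - X 2 ^ 3)` is prime. [OURS · F4 (c) on B9] -/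
theorem isPrime_pair_c0 : (Ideal.span {(1 + X 3 * (1 + X 0 ^ 9 + X 1 ^ 9 + X 2 ^ 9) : MvPolynomial (Fin 5) k), X 1 ^ 2 - X 2 ^ 3}).IsPrime := by
  refine isPrime_pair_of_swap03 k (X 0 ^ 2 - X 1 ^ 3) (1 + X 0 ^ 9 + X 1 ^ 9 + X 2 ^ 9) (-1) (prime_sq_sub_cube k (m := 2)) (not_dvd_of_eval k (![0, 0, 0, 0] : Fin 4 → k) (by simp) (by simp))
    (fun t ht => by rwa [neg_one_mul, Ideal.neg_mem_iff] at ht) _ _ ?_ ?_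
  · simp [rename_X, Equiv.swap_apply_of_ne_of_ne]; ring
  · simp [rename_X, Equiv.swap_apply_of_ne_of_ne]

/-- ★ Chart 6 (type T1): `(θ_T1, X 1 ^ 2 * X 2 - 1)` is prime. [OURS · F4 (c) on B9] -/
theorem isPrime_pair_c6 : (Ideal.span {(1 + X 3 * (1 + X 0 ^ 9 + X 1 ^ 9 + X 2 ^ 9) : MvPolynomial (Fin 5) k), X 1 ^ 2 * X 2 - 1}).IsPrime := by
  refine isPrime_pair_of_swap03 k (X 0 ^ 2 * X 1 - 1) (1 + X 0 ^ 9 + X 1 ^ 9 + X 2 ^ 9) (-1) (prime_G6 k) (not_dvd_of_eval k (![-1, 1, 0, 0] : Fin 4 → k) (by simp) (by simp [show ((-1 : k)) ^ 9 = -1 by norm_num]))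
    (fun t ht => by rwa [neg_one_mul, Ideal.neg_mem_iff] at ht) _ _ ?_ ?_
  · simp [rename_X, Equiv.swap_apply_of_ne_of_ne]; ring
  · simp [rename_X, Equiv.swap_apply_of_ne_of_ne]

/-- ★ Chart 12 (type T1): `(θ_T1, X 2 - X 1 ^ 3)` is prime. [OURS · F4 (c) on B9] -/
theorem isPrime_pair_c12 : (Ideal.span {(1 + X 3 * (1 + X 0 ^ 9 + X 1 ^ 9 + X 2 ^ 9) : MvPolynomial (Fin 5) k), X 2 - X 1 ^ 3}).IsPrime := by
  refine isPrime_pair_of_swap03 k (X 1 - X 0 ^ 3) (1 + X 0 ^ 9 + X 1 ^ 9 + X 2 ^ 9) (-1) (prime_G12 k) (not_dvd_of_eval k (![0, 0, 0, 0] : Fin 4 → k) (by simp) (by simp))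
    (fun t ht => by rwa [neg_one_mul, Ideal.neg_mem_iff] at ht) _ _ ?_ ?_
  · simp [rename_X, Equiv.swap_apply_of_ne_of_ne]; ring
  · simp [rename_X, Equiv.swap_apply_of_ne_of_ne]

/-- ★ Chart 18 (type T1): `(θ_T1, X 0 ^ 2 * X 2 - X 1 ^ 3)` is prime. [OURS · F4 (c) on B9] -/
theorem isPrime_pair_c18 : (Ideal.span {(1 + X 3 * (1 + X 0 ^ 9 + X 1 ^ 9 + X 2 ^ 9) : MvPolynomial (Fin 5) k), X 0 ^ 2 * X 2 - X 1 ^ 3}).IsPrime := by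
  refine isPrime_pair_of_swap03 k (X 2 ^ 2 * X 1 - X 0 ^ 3) (1 + X 0 ^ 9 + X 1 ^ 9 + X 2 ^ 9) (-1) (prime_G18 k) (not_dvd_of_eval k (![0, 0, 0, 0] : Fin 4 → k) (by simp) (by simp))
    (fun t ht => by rwa [neg_one_mul, Ideal.neg_mem_iff] at ht) _ _ ?_ ?_
  · simp [rename_X, Equiv.swap_apply_of_ne_of_ne]; ring
  · simp [rename_X, Equiv.swap_apply_of_ne_of_ne]

/-- ★ Chart 4 (type T2): `(θ_T2, X 1 ^ 2 - X 2 ^ 3)` is prime. [OURS · F4 (c) on B9] -/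
theorem isPrime_pair_c4 : (Ideal.span {(X 3 + (1 + X 0 ^ 9 + X 1 ^ 9 + X 2 ^ 9) : MvPolynomial (Fin 5) k), X 1 ^ 2 - X 2 ^ 3}).IsPrime := by
  refine isPrime_pair_of_swap03 k (X 0 ^ 2 - X 1 ^ 3) 1 (-(1 + X 0 ^ 9 + X 1 ^ 9 + X 2 ^ 9)) (prime_sq_sub_cube k (m := 2)) (fun h => (prime_sq_sub_cube k (m := 2)).not_unit (isUnit_of_dvd_one h))
    (fun t _ => Ideal.mem_span_pair.mpr ⟨0, t, by ring⟩) _ _ ?_ ?_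
  · simp [rename_X, Equiv.swap_apply_of_ne_of_ne]; ring
  · simp [rename_X, Equiv.swap_apply_of_ne_of_ne]

/-- ★ Chart 10 (type T2): `(θ_T2, X 1 ^ 2 * X 2 - 1)` is prime. [OURS · F4 (c) on B9] -/
theorem isPrime_pair_c10 : (Ideal.span {(X 3 + (1 + X 0 ^ 9 + X 1 ^ 9 + X 2 ^ 9) : MvPolynomial (Fin 5) k), X 1 ^ 2 * X 2 - 1}).IsPrime := by
  refine isPrime_pair_of_swap03 k (X 0 ^ 2 * X 1 - 1) 1 (-(1 + X 0 ^ 9 + X 1 ^ 9 + X 2 ^ 9)) (prime_G6 k) (fun h => (prime_G6 k).not_unit (isUnit_of_dvd_one h))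
    (fun t _ => Ideal.mem_span_pair.mpr ⟨0, t, by ring⟩) _ _ ?_ ?_
  · simp [rename_X, Equiv.swap_apply_of_ne_of_ne]; ring
  · simp [rename_X, Equiv.swap_apply_of_ne_of_ne]

/-- ★ Chart 16 (type T2): `(θ_T2, X 2 - X 1 ^ 3)` is prime. [OURS · F4 (c) on B9] -/
theorem isPrime_pair_c16 : (Ideal.span {(X 3 + (1 + X 0 ^ 9 + X 1 ^ 9 + X 2 ^ 9) : MvPolynomial (Fin 5) k), X 2 - X 1 ^ 3}).IsPrime := by
  refine isPrime_pair_of_swap03 k (X 1 - X 0 ^ 3) 1 (-(1 + X 0 ^ 9 + X 1 ^ 9 + X 2 ^ 9)) (prime_G12 k) (fun h => (prime_G12 k).not_unit (isUnit_of_dvd_one h))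
    (fun t _ => Ideal.mem_span_pair.mpr ⟨0, t, by ring⟩) _ _ ?_ ?_
  · simp [rename_X, Equiv.swap_apply_of_ne_of_ne]; ring
  · simp [rename_X, Equiv.swap_apply_of_ne_of_ne]

/-- ★ Chart 22 (type T2): `(θ_T2, X 0 ^ 2 * X 2 - X 1 ^ 3)` is prime. [OURS · F4 (c) on B9] -/
theorem isPrime_pair_c22 : (Ideal.span {(X 3 + (1 + X 0 ^ 9 + X 1 ^ 9 + X 2 ^ 9) : MvPolynomial (Fin 5) k), X 0 ^ 2 * X 2 - X 1 ^ 3}).IsPrime := by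
  refine isPrime_pair_of_swap03 k (X 2 ^ 2 * X 1 - X 0 ^ 3) 1 (-(1 + X 0 ^ 9 + X 1 ^ 9 + X 2 ^ 9)) (prime_G18 k) (fun h => (prime_G18 k).not_unit (isUnit_of_dvd_one h))
    (fun t _ => Ideal.mem_span_pair.mpr ⟨0, t, by ring⟩) _ _ ?_ ?_
  · simp [rename_X, Equiv.swap_apply_of_ne_of_ne]; ring
  · simp [rename_X, Equiv.swap_apply_of_ne_of_ne]

/-- ★ Chart 5 (type T3): `(θ_T3, X 2 ^ 2 - X 3 ^ 3)` is prime. [OURS · F4 (c) on B9] -/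
theorem isPrime_pair_c5 : (Ideal.span {(X 0 ^ 2 * X 4 + (1 + X 1 ^ 9 + X 2 ^ 9 + X 3 ^ 9) : MvPolynomial (Fin 5) k), X 2 ^ 2 - X 3 ^ 3}).IsPrime := by
  have hs0 : (Fin.succ (0 : Fin 3) : Fin 4) = 1 := rfl
  have hs1 : (Fin.succ (1 : Fin 3) : Fin 4) = 2 := rfl
  have hs2 : (Fin.succ (2 : Fin 3) : Fin 4) = 3 := rfl
  have hc0 : (Fin.castSucc (0 : Fin 4) : Fin 5) = 0 := rfl
  have hc1 : (Fin.castSucc (1 : Fin 4) : Fin 5) = 1 := rfl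
  have hc2 : (Fin.castSucc (2 : Fin 4) : Fin 5) = 2 := rfl
  have hc3 : (Fin.castSucc (3 : Fin 4) : Fin 5) = 3 := rfl
  have hl : (Fin.last 4 : Fin 5) = 4 := rfl
  refine isPrime_pair_T3 k (X 1 ^ 2 - X 2 ^ 3) (1 + X 0 ^ 9 + X 1 ^ 9 + X 2 ^ 9) (prime_H5 k) (not_dvd_of_eval k (![0, 0, 0] : Fin 3 → k) (by simp) (by simp))
    (not_dvd_of_eval k (![1, 0, 0, 0] : Fin 4 → k) (by simp [hs1, hs2]) (by simp)) _ _ ?_ ?_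
  · simp [rename_X, hs0, hs1, hs2, hc0, hc1, hc2, hc3, hl]; ring
  · simp [rename_X, hs1, hs2, hc2, hc3]

/-- ★ Chart 11 (type T3): `(θ_T3, X 2 ^ 2 * X 3 - 1)` is prime. [OURS · F4 (c) on B9] -/
theorem isPrime_pair_c11 : (Ideal.span {(X 0 ^ 2 * X 4 + (1 + X 1 ^ 9 + X 2 ^ 9 + X 3 ^ 9) : MvPolynomial (Fin 5) k), X 2 ^ 2 * X 3 - 1}).IsPrime := by
  have hs0 : (Fin.succ (0 : Fin 3) : Fin 4) = 1 := rfl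
  have hs1 : (Fin.succ (1 : Fin 3) : Fin 4) = 2 := rfl
  have hs2 : (Fin.succ (2 : Fin 3) : Fin 4) = 3 := rfl
  have hc0 : (Fin.castSucc (0 : Fin 4) : Fin 5) = 0 := rfl
  have hc1 : (Fin.castSucc (1 : Fin 4) : Fin 5) = 1 := rfl
  have hc2 : (Fin.castSucc (2 : Fin 4) : Fin 5) = 2 := rfl
  have hc3 : (Fin.castSucc (3 : Fin 4) : Fin 5) = 3 := rfl
  have hl : (Fin.last 4 : Fin 5) = 4 := rfl
  refine isPrime_pair_T3 k (X 1 ^ 2 * X 2 - 1) (1 + X 0 ^ 9 + X 1 ^ 9 + X 2 ^ 9) (prime_H11 k) (not_dvd_of_eval k (![0, -1, 1] : Fin 3 → k) (by simp) (by simp [show ((-1 : k)) ^ 9 = -1 by norm_num]))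
    (not_dvd_of_eval k (![1, 0, 1, 1] : Fin 4 → k) (by simp [hs1, hs2]) (by simp)) _ _ ?_ ?_
  · simp [rename_X, hs0, hs1, hs2, hc0, hc1, hc2, hc3, hl]; ring
  · simp [rename_X, hs1, hs2, hc2, hc3]

/-- ★ Chart 17 (type T3): `(θ_T3, X 3 - X 2 ^ 3)` is prime. [OURS · F4 (c) on B9] -/
theorem isPrime_pair_c17 : (Ideal.span {(X 0 ^ 2 * X 4 + (1 + X 1 ^ 9 + X 2 ^ 9 + X 3 ^ 9) : MvPolynomial (Fin 5) k), X 3 - X 2 ^ 3}).IsPrime := by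
  have hs0 : (Fin.succ (0 : Fin 3) : Fin 4) = 1 := rfl
  have hs1 : (Fin.succ (1 : Fin 3) : Fin 4) = 2 := rfl
  have hs2 : (Fin.succ (2 : Fin 3) : Fin 4) = 3 := rfl
  have hc0 : (Fin.castSucc (0 : Fin 4) : Fin 5) = 0 := rfl
  have hc1 : (Fin.castSucc (1 : Fin 4) : Fin 5) = 1 := rfl
  have hc2 : (Fin.castSucc (2 : Fin 4) : Fin 5) = 2 := rfl
  have hc3 : (Fin.castSucc (3 : Fin 4) : Fin 5) = 3 := rfl
  have hl : (Fin.last 4 : Fin 5) = 4 := rfl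
  refine isPrime_pair_T3 k (X 2 - X 1 ^ 3) (1 + X 0 ^ 9 + X 1 ^ 9 + X 2 ^ 9) (prime_H17 k) (not_dvd_of_eval k (![0, 0, 0] : Fin 3 → k) (by simp) (by simp))
    (not_dvd_of_eval k (![1, 0, 0, 0] : Fin 4 → k) (by simp [hs1, hs2]) (by simp)) _ _ ?_ ?_
  · simp [rename_X, hs0, hs1, hs2, hc0, hc1, hc2, hc3, hl]; ring
  · simp [rename_X, hs1, hs2, hc2, hc3]

/-- ★ Chart 23 (type T3): `(θ_T3, X 1 ^ 2 * X 3 - X 2 ^ 3)` is prime. [OURS · F4 (c) on B9] -/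
theorem isPrime_pair_c23 : (Ideal.span {(X 0 ^ 2 * X 4 + (1 + X 1 ^ 9 + X 2 ^ 9 + X 3 ^ 9) : MvPolynomial (Fin 5) k), X 1 ^ 2 * X 3 - X 2 ^ 3}).IsPrime := by
  have hs0 : (Fin.succ (0 : Fin 3) : Fin 4) = 1 := rfl
  have hs1 : (Fin.succ (1 : Fin 3) : Fin 4) = 2 := rfl
  have hs2 : (Fin.succ (2 : Fin 3) : Fin 4) = 3 := rfl
  have hc0 : (Fin.castSucc (0 : Fin 4) : Fin 5) = 0 := rfl
  have hc1 : (Fin.castSucc (1 : Fin 4) : Fin 5) = 1 := rfl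
  have hc2 : (Fin.castSucc (2 : Fin 4) : Fin 5) = 2 := rfl
  have hc3 : (Fin.castSucc (3 : Fin 4) : Fin 5) = 3 := rfl
  have hl : (Fin.last 4 : Fin 5) = 4 := rfl
  refine isPrime_pair_T3 k (X 0 ^ 2 * X 2 - X 1 ^ 3) (1 + X 0 ^ 9 + X 1 ^ 9 + X 2 ^ 9) (prime_H23 k) (not_dvd_of_eval k (![0, 0, 0] : Fin 3 → k) (by simp) (by simp))
    (not_dvd_of_eval k (![1, 0, 0, 0] : Fin 4 → k) (by simp [hs0, hs1, hs2]) (by simp)) _ _ ?_ ?_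
  · simp [rename_X, hs0, hs1, hs2, hc0, hc1, hc2, hc3, hl]; ring
  · simp [rename_X, hs0, hs1, hs2, hc1, hc2, hc3]


end Summit.ResolutionOfSingularities.ResolutionOfSingularities.Theorems.FInjectiveMacaulayfication.B9OmegaChartPrimes

end
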